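import Literature.Probability.Percolation.KestenScalingThetaProofs
import Literature.Probability.Percolation.NearCriticalScalingProofs
import HarnessLib

/-!
# Equivalence of the characteristic lengths `L_ε ≍ L_{ε'}` (Nolin 2008, Cor. 37), proofs only

Topic `Literature/Probability/Percolation`; family `crit-perc`. Proofs only (no new definition, no
new named fact), towards the discharge of the named facts `Nolin2008_theta_asymp`
(`KestenScaling.lean`) and `Nolin2008_cor41` (`NearCriticalScaling.lean`) for EVERY `ε ∈ (0, 1/2)`.

P. Nolin, *Near-critical percolation in two dimensions*, Electron. J. Probab. 13 (2008), §7.3,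
Cor. 37 [arXiv 0711.4948: Cor. 35]: "For any `ε, ε' ∈ (0, 1/2)`, `L_ε(p) ≍ L_{ε'}(p)`." Printed
proof: "assume that `ε ≤ ε'`, so that `L_ε(p) ≥ L_{ε'}(p)`, and we need to prove that
`L_ε(p) ≤ C L_{ε'}(p)`. We know that `|p - 1/2| L_ε² π₄(L_ε) ≍ 1 ≍ |p - 1/2| L_{ε'}² π₄(L_{ε'})`
[Prop. 34], hence `L_ε² π₄(L_ε) / (L_{ε'}² π₄(L_{ε'})) ≤ C₁`. This yields
`(L_ε/L_{ε'})² ≤ C₁ π₄(L_{ε'})/π₄(L_ε) ≤ C₂ π₄(L_{ε'}, L_ε)⁻¹` by quasi-multiplicativity. Now we use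
the a-priori bound for 4 arms given by the 5-arm exponent:
`π₄(L_{ε'}, L_ε) ≥ C₃ (L_{ε'}/L_ε)^{2-α'}`. Together … `L_ε(p) ≤ C₄^{1/α'} L_{ε'}(p)`."

## What is proved

* `critFourArmProb_quasiMult`, `critFourArmProb_lowerBound` — the CRITICAL (`t = 1/2`) instances
  of the tree's near-critical named facts `Werner2009_fourArm_quasiMult` (Werner 2009, Lecture 6,
  Cor. 6.2; Nolin Prop. 17) and `Werner2009_fourArm_lowerBound` (Werner §3; Nolin Thm. 24 with the
  five-arm exponent) of `NearCriticalFourArmFacts.lean`, where the restriction `S ≤ L(t, ε)` is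
  void at `t = 1/2`.
* `CharLengthEquivalence.core` — the real-arithmetic core of the printed proof: from
  `x A² π₄(r₀, A) ≤ C₁`, `c₂ ≤ x B² π₄(r₀, B)`, `c_Q π₄(r₀, B) π₄(4B, A) ≤ π₄(r₀, A)` and
  `c_L (4B/A)^{2-β} ≤ π₄(4B, A)` one gets `A ≤ (C₁/(c₂ c_Q c_L 4^{2-β}))^{1/β} B`.
* `charLength_le_mul_charLength_at` — **Cor. 37, non-trivial inequality**: for `0 < ε ≤ ε' < 1/2`,
  `L_ε(p) ≤ K · L_{ε'}(p)` on a punctured neighbourhood of `1/2`, from the UPPER bound of Kesten's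
  relation at `ε`, the LOWER bound at `ε'` (the one-sided bodies of `Nolin2008_prop34`, in the
  shape of `Nolin2008_prop34_upper_at_of_pivotal_lower` / `Nolin2008_prop34_lower_at_of_pivotal_upper`
  of `KestenScalingProofs.lean`), and the two four-arm facts; `charLength_le_mul_charLength` — the
  same from `Nolin2008_prop34`. (The trivial inequality `L_{ε'} ≤ L_ε` is `charLength_anti`,
  `KestenRelationRussoProofs.lean`.) As printed, only the upper Kesten bound at the SMALLER `ε` and
  the lower one at the LARGER `ε'` enter.
* Assemblies: `charLength_lengths_of_prop34` (the comparison in the shape `hlen` consumed by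
  `NearCriticalScalingProofs.lean`), `Nolin2008_lemma39_of_prop34` and `Nolin2008_cor41_of_prop34 :
  Nolin2008_RSW_one → Nolin2008_prop34 → Werner2009_fourArm_quasiMult →
  Werner2009_fourArm_lowerBound → Nolin2008_lemma39 / Nolin2008_cor41` (through
  `Nolin2008_lemma39_of_RSW_one_of_lengths` / `Nolin2008_cor41_of_RSW_one_of_lengths`), and for
  `Nolin2008_theta_asymp` (through `Nolin2008_theta_asymp_of_facts`, `KestenScalingThetaProofs.lean`):
  `Nolin2008_theta_asymp_of_prop34` (the five near-critical arm facts of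
  `TriThetaExponentFromFacts.lean` + `Nolin2008_RSW_one` + `Nolin2008_prop34`) and
  `Nolin2008_theta_asymp_of_lemma62` (the same with Kesten's relation supplied by the pivotal count
  `Werner2009_lemma62`, `Nolin2008_prop34_of_expDecay`).

Inner radius. Nolin's `π₄(N) = π₄(n₀(4), N)`; the tree's `critFourArmProb r₀ N` carries the inner
radius explicitly and `Nolin2008_prop34` holds for every large `r₀`, so `r₀` is chosen above the
thresholds of the two four-arm facts, and `L_{ε'}(p) > 4 r₀` near `1/2` by Nolin's Prop. 4
(`le_charLength_eventually`).

## References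

* P. Nolin, Near-critical percolation in two dimensions, *Electron. J. Probab.* 13 (2008), §7.3,
  Prop. 34, Cor. 37 (arXiv 0711.4948: Prop. 32, Cor. 35); §7.4, Lemma 39, Cor. 41, eq. (7.25)
  [Nolin2008].
* W. Werner, Lectures on two-dimensional critical percolation, PCMI (2009), Lecture 6, §3 and
  Cor. 6.2 [WernerPCMI2009].
* H. Kesten, Scaling relations for 2D-percolation, *Comm. Math. Phys.* 109 (1987) [KestenScalingCMP1987].

Tree: `Nolin2008_prop34`, `charLength`, `critFourArmProb` (`KestenScaling.lean`);
`Werner2009_fourArm_quasiMult`, `Werner2009_fourArm_lowerBound` (`NearCriticalFourArmFacts.lean`);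
`fourArmProbAt_half` (`WernerPivotalEstimates.lean`); `charLength_anti`,
`BollobasRiordan2006_ch5_lemma7_holds`, `Nolin2008_prop34_of_expDecay`
(`KestenRelationRussoProofs.lean`); `le_charLength_eventually` (`KestenRelationRusso.lean`);
`Nolin2008_subcritical_crossing_holds` (`NearCriticalRSW.lean`);
`BollobasRiordan2006_tri_expDecay_holds` (`TriSubcriticalCrossingProofs.lean`);
`Nolin2008_cor41_of_RSW_one_of_lengths` (`NearCriticalScalingProofs.lean`);
`Nolin2008_theta_asymp_of_facts` (`KestenScalingThetaProofs.lean`). Mathlib: `Real.rpow`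
(`Real.div_rpow`, `Real.mul_rpow`, `Real.rpow_sub`, `Real.rpow_add`, `Real.le_rpow_inv_iff_of_pos`).
-/

noncomputable section

open Filter Topology MeasureTheory Set
open scoped unitInterval

namespace Literature.Probability.Percolation

open LatticeModels

/-! ### The critical instances of the two four-arm facts -/

/-- **Quasi-multiplicativity of the critical four-arm probability** (Werner 2009, Lecture 6,
Cor. 6.2 at `p = 1/2`; Nolin 2008, Prop. 17 [arXiv 0711.4948: Prop. 16]; Kesten 1987): the
instance `t = 1/2` of the tree's named fact `Werner2009_fourArm_quasiMult`, where the restriction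
`S ≤ L(t, ε)` is void — there are `r₁` and `c > 0` with
`c · π₄(r, R) · π₄(4R, S) ≤ π₄(r, S)` for `r₁ ≤ r`, `16 r < 4 R` and `4 R < S`
(`π₄ = critFourArmProb`). [cite: WernerPCMI2009, Lecture 6, Cor. 6.2] [cite: Nolin2008, Prop. 17 (arXiv 0711.4948: Prop. 16)] -/
theorem critFourArmProb_quasiMult (hQM : Werner2009_fourArm_quasiMult) :
    ∃ r₁ : ℕ, ∃ c > (0 : ℝ), ∀ r R S : ℕ, r₁ ≤ r → 16 * r < 4 * R → 4 * R < S →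
      c * (critFourArmProb r R * critFourArmProb (4 * R) S) ≤ critFourArmProb r S := by
  obtain ⟨ε₁, hε₁, h⟩ := hQM
  obtain ⟨r₁, δ, hδ, c, hc, hb⟩ := h (half_pos hε₁) (half_lt_self hε₁)
  refine ⟨r₁, c, hc, fun r R S hr hR hS => ?_⟩
  have h' := hb half coe_half.ge (by rw [coe_half]; linarith) r R S hr hR hS
    (fun hlt => absurd hlt (by rw [coe_half]; exact lt_irrefl _))
  simpa only [fourArmProbAt_half] using h'

/-- **A priori lower bound for the critical four-arm probability, exponent `< 2`** (Werner 2009,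
Lecture 6, §3, third estimate, at `p = 1/2`; Nolin 2008, proof of Cor. 37: "the a-priori bound for
`4` arms given by the `5`-arm exponent", `π₄(n, N) ≥ C₃ (n/N)^{2-α'}`): the instance `t = 1/2` of
the tree's named fact `Werner2009_fourArm_lowerBound` — there are `r₁`, `β > 0`, `c > 0` with
`c · (m/n)^{2-β} ≤ π₄(m, n)` for `r₁ ≤ m ≤ n`. [cite: WernerPCMI2009, Lecture 6, §3 (third a priori estimate)] [cite: Nolin2008, §7.3, proof of Cor. 37 (arXiv 0711.4948: Cor. 35)] -/
theorem critFourArmProb_lowerBound (hLB : Werner2009_fourArm_lowerBound) :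
    ∃ r₁ : ℕ, ∃ β > (0 : ℝ), ∃ c > (0 : ℝ), ∀ m n : ℕ, r₁ ≤ m → m ≤ n →
      c * ((m : ℝ) / n) ^ (2 - β) ≤ critFourArmProb m n := by
  obtain ⟨ε₁, hε₁, h⟩ := hLB
  obtain ⟨r₁, δ, hδ, β, hβ, c, hc, hb⟩ := h (half_pos hε₁) (half_lt_self hε₁)
  refine ⟨r₁, β, hβ, c, hc, fun m n hm hmn => ?_⟩
  have h' := hb half coe_half.ge (by rw [coe_half]; linarith) m n hm hmn
    (fun hlt => absurd hlt (by rw [coe_half]; exact lt_irrefl _))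
  simpa only [fourArmProbAt_half] using h'

/-! ### The real-arithmetic core -/

/-- **Core of the proof of Cor. 37** (Nolin 2008, §7.3, proof of Cor. 37 [arXiv: Cor. 35], the
chain of displays): if `x A² π_a ≤ C₁` (upper Kesten bound at the smaller `ε`, `A = L_ε`),
`c₂ ≤ x B² π_b` (lower Kesten bound at the larger `ε'`, `B = L_{ε'}`), `c_Q π_b π_{ba} ≤ π_a`
(quasi-multiplicativity, `π_{ba} = π₄(4B, A)`) and `c_L (4B/A)^{2-β} ≤ π_{ba}` (a priori bound),
then `A ≤ (C₁ / (c₂ c_Q c_L 4^{2-β}))^{1/β} · B`. Indeed the four inequalities multiply to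
`c₂ c_Q c_L 4^{2-β} A^β B^{2-β} ≤ C₁ B²`, i.e. `(A/B)^β ≤ C₁ / (c₂ c_Q c_L 4^{2-β})`. [cite: Nolin2008, §7.3, proof of Cor. 37 (arXiv 0711.4948: Cor. 35)] -/
theorem CharLengthEquivalence.core {A B x c₂ C₁ cQ cL β πa πb πba : ℝ}
    (hA : 0 < A) (hB : 0 < B) (hx : 0 ≤ x) (hc₂ : 0 < c₂) (hcQ : 0 < cQ) (hcL : 0 < cL)
    (hβ : 0 < β) (hπa : 0 ≤ πa) (hπb : 0 ≤ πb)
    (hK₁ : x * A ^ 2 * πa ≤ C₁) (hK₂ : c₂ ≤ x * B ^ 2 * πb)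
    (hQ : cQ * (πb * πba) ≤ πa) (hL : cL * (4 * B / A) ^ (2 - β) ≤ πba) :
    A ≤ (C₁ / (c₂ * cQ * cL * (4 : ℝ) ^ (2 - β))) ^ β⁻¹ * B := by
  have hD : 0 < c₂ * cQ * cL * (4 : ℝ) ^ (2 - β) := by positivity
  have hZ : 0 ≤ (4 * B / A) ^ (2 - β) := Real.rpow_nonneg (by positivity) _
  -- (1) `c_Q c_L (4B/A)^{2-β} π_b ≤ π_a`
  have h1 : cQ * cL * (4 * B / A) ^ (2 - β) * πb ≤ πa := by
    calc cQ * cL * (4 * B / A) ^ (2 - β) * πb = cQ * (πb * (cL * (4 * B / A) ^ (2 - β))) := by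
          ring
      _ ≤ cQ * (πb * πba) :=
          mul_le_mul_of_nonneg_left (mul_le_mul_of_nonneg_left hL hπb) hcQ.le
      _ ≤ πa := hQ
  -- (2) times `x A²`
  have h2 : x * A ^ 2 * (cQ * cL * (4 * B / A) ^ (2 - β) * πb) ≤ C₁ :=
    (mul_le_mul_of_nonneg_left h1 (by positivity)).trans hK₁
  -- (3) times `B²`, using `c₂ ≤ x B² π_b`
  have h3 : c₂ * (cQ * cL * (A ^ 2 * (4 * B / A) ^ (2 - β))) ≤ C₁ * B ^ 2 := by
    have hW : 0 ≤ cQ * cL * (A ^ 2 * (4 * B / A) ^ (2 - β)) := by positivity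
    calc c₂ * (cQ * cL * (A ^ 2 * (4 * B / A) ^ (2 - β)))
        ≤ x * B ^ 2 * πb * (cQ * cL * (A ^ 2 * (4 * B / A) ^ (2 - β))) :=
          mul_le_mul_of_nonneg_right hK₂ hW
      _ = B ^ 2 * (x * A ^ 2 * (cQ * cL * (4 * B / A) ^ (2 - β) * πb)) := by ring
      _ ≤ B ^ 2 * C₁ := mul_le_mul_of_nonneg_left h2 (by positivity)
      _ = C₁ * B ^ 2 := by ring
  -- (4) the identities `A² (4B/A)^{2-β} = 4^{2-β} A^β B^{2-β}` and `B² = B^β B^{2-β}`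
  have hid : A ^ 2 * (4 * B / A) ^ (2 - β) = (4 : ℝ) ^ (2 - β) * A ^ β * B ^ (2 - β) := by
    rw [Real.div_rpow (by positivity) hA.le, Real.mul_rpow (by norm_num) hB.le, ← Real.rpow_two]
    have hAβ : A ^ (2 : ℝ) / A ^ (2 - β) = A ^ β := by
      rw [← Real.rpow_sub hA]; congr 1; ring
    calc A ^ (2 : ℝ) * ((4 : ℝ) ^ (2 - β) * B ^ (2 - β) / A ^ (2 - β))
        = (4 : ℝ) ^ (2 - β) * (A ^ (2 : ℝ) / A ^ (2 - β)) * B ^ (2 - β) := by ring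
      _ = (4 : ℝ) ^ (2 - β) * A ^ β * B ^ (2 - β) := by rw [hAβ]
  have hB2 : B ^ 2 = B ^ β * B ^ (2 - β) := by
    rw [← Real.rpow_two, ← Real.rpow_add hB]; congr 1; ring
  -- (5) cancel `B^{2-β} > 0`
  have hBpow : 0 < B ^ (2 - β) := Real.rpow_pos_of_pos hB _
  have h5 : c₂ * cQ * cL * (4 : ℝ) ^ (2 - β) * A ^ β ≤ C₁ * B ^ β := by
    refine le_of_mul_le_mul_right ?_ hBpow
    calc c₂ * cQ * cL * (4 : ℝ) ^ (2 - β) * A ^ β * B ^ (2 - β)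
        = c₂ * (cQ * cL * (A ^ 2 * (4 * B / A) ^ (2 - β))) := by rw [hid]; ring
      _ ≤ C₁ * B ^ 2 := h3
      _ = C₁ * B ^ β * B ^ (2 - β) := by rw [hB2]; ring
  -- (6) `(A/B)^β ≤ M`
  have hBβ : 0 < B ^ β := Real.rpow_pos_of_pos hB _
  have h6 : (A / B) ^ β ≤ C₁ / (c₂ * cQ * cL * (4 : ℝ) ^ (2 - β)) := by
    rw [Real.div_rpow hA.le hB.le, div_le_iff₀ hBβ, div_mul_eq_mul_div, le_div_iff₀ hD]
    calc A ^ β * (c₂ * cQ * cL * (4 : ℝ) ^ (2 - β))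
        = c₂ * cQ * cL * (4 : ℝ) ^ (2 - β) * A ^ β := by ring
      _ ≤ C₁ * B ^ β := h5
  -- (7) take the `β`-th root
  have hC₁ : 0 ≤ C₁ := le_trans (by positivity) hK₁
  have hM : 0 ≤ C₁ / (c₂ * cQ * cL * (4 : ℝ) ^ (2 - β)) := div_nonneg hC₁ hD.le
  have h7 : A / B ≤ (C₁ / (c₂ * cQ * cL * (4 : ℝ) ^ (2 - β))) ^ β⁻¹ :=
    (Real.le_rpow_inv_iff_of_pos (by positivity) hM hβ).2 h6
  rwa [div_le_iff₀ hB] at h7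

/-! ### Cor. 37: `L_ε(p) ≤ K · L_{ε'}(p)` near `1/2` -/

/-- **Equivalence of lengths, non-trivial inequality, from one-sided Kesten bounds** (Nolin 2008,
§7.3, Cor. 37 [arXiv 0711.4948: Cor. 35]: `L_ε(p) ≍ L_{ε'}(p)` for `ε, ε' ∈ (0, 1/2)`). Let
`0 < ε ≤ ε' < 1/2`. Assume, for every large inner radius `r₀`, the UPPER bound
`|p - 1/2| L_ε(p)² π₄(r₀, L_ε(p)) ≤ C` of Kesten's relation at `ε` and the LOWER bound
`c ≤ |p - 1/2| L_{ε'}(p)² π₄(r₀, L_{ε'}(p))` at `ε'`, each on a punctured neighbourhood of `1/2`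
(the one-sided bodies of `Nolin2008_prop34`), together with the two four-arm facts of
`NearCriticalFourArmFacts.lean` (used at `p = 1/2` only). Then there are `δ > 0` and `K > 0` with
`L_ε(p) ≤ K · L_{ε'}(p)` for `p ≠ 1/2`, `|p - 1/2| < δ`. Proof as printed (see the module
docstring), through `CharLengthEquivalence.core` with `A = L_ε(p)`, `B = L_{ε'}(p) > 4 r₀`
(`le_charLength_eventually`), in the case `4B < A` (otherwise `K = 4` does). [cite: Nolin2008, §7.3, Cor. 37 (arXiv 0711.4948: Cor. 35)] -/
theorem charLength_le_mul_charLength_at {ε ε' : ℝ} (hε : 0 < ε) (hεε' : ε ≤ ε') (hε' : ε' < 1 / 2)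
    (hQM : Werner2009_fourArm_quasiMult) (hLB : Werner2009_fourArm_lowerBound)
    (hKup : ∃ r₁ : ℕ, ∀ r₀ ≥ r₁, ∃ δ > (0 : ℝ), ∃ C : ℝ,
      ∀ p : unitInterval, (p : ℝ) ≠ 1 / 2 → |(p : ℝ) - 1 / 2| < δ →
        |(p : ℝ) - 1 / 2| * (charLength ε p : ℝ) ^ 2 * critFourArmProb r₀ (charLength ε p) ≤ C)
    (hKlow : ∃ r₁ : ℕ, ∀ r₀ ≥ r₁, ∃ δ > (0 : ℝ), ∃ c > (0 : ℝ),
      ∀ p : unitInterval, (p : ℝ) ≠ 1 / 2 → |(p : ℝ) - 1 / 2| < δ →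
        c ≤ |(p : ℝ) - 1 / 2| * (charLength ε' p : ℝ) ^ 2 *
          critFourArmProb r₀ (charLength ε' p)) :
    ∃ δ > (0 : ℝ), ∃ K > (0 : ℝ), ∀ p : unitInterval, (p : ℝ) ≠ 1 / 2 → |(p : ℝ) - 1 / 2| < δ →
      (charLength ε p : ℝ) ≤ K * charLength ε' p := by
  have hsub := Nolin2008_subcritical_crossing_holds
  obtain ⟨rQ, cQ, hcQ, hQ⟩ := critFourArmProb_quasiMult hQM
  obtain ⟨rL, β, hβ, cL, hcL, hL⟩ := critFourArmProb_lowerBound hLB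
  obtain ⟨r₁, hr₁⟩ := hKup
  obtain ⟨r₁', hr₁'⟩ := hKlow
  set r₀ : ℕ := max (max r₁ r₁') (max rQ rL)
  obtain ⟨δ₁, hδ₁, C₁, hb₁⟩ := hr₁ r₀ ((le_max_left _ _).trans (le_max_left _ _))
  obtain ⟨δ₂, hδ₂, c₂, hc₂, hb₂⟩ := hr₁' r₀ ((le_max_right _ _).trans (le_max_left _ _))
  have hrQ : rQ ≤ r₀ := (le_max_left _ _).trans (le_max_right _ _)
  have hrL : rL ≤ r₀ := (le_max_right _ _).trans (le_max_right _ _)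
  -- `L_{ε'}(p) ≥ 4 r₀ + 1` near `1/2` (Nolin's Prop. 4)
  obtain ⟨δ₃, hδ₃, h₃⟩ := le_charLength_eventually BollobasRiordan2006_ch5_lemma7_holds hsub
    (hε.trans_le hεε') hε' (4 * r₀ + 1)
  set K : ℝ := max 4 ((C₁ / (c₂ * cQ * cL * (4 : ℝ) ^ (2 - β))) ^ β⁻¹)
  refine ⟨min (min δ₁ δ₂) δ₃, lt_min (lt_min hδ₁ hδ₂) hδ₃, K, lt_max_of_lt_left (by norm_num),
    fun p hp hpδ => ?_⟩
  have hpδ₁ : |(p : ℝ) - 1 / 2| < δ₁ := hpδ.trans_le ((min_le_left _ _).trans (min_le_left _ _))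
  have hpδ₂ : |(p : ℝ) - 1 / 2| < δ₂ :=
    hpδ.trans_le ((min_le_left _ _).trans (min_le_right _ _))
  have hpδ₃ : |(p : ℝ) - 1 / 2| < δ₃ := hpδ.trans_le (min_le_right _ _)
  set a : ℕ := charLength ε p
  set b : ℕ := charLength ε' p
  -- `b ≥ 4 r₀ + 1`: below `1/2` directly, above `1/2` through `L(1 - p) = L(p)`
  have hb4 : 4 * r₀ + 1 ≤ b := by
    rcases lt_or_gt_of_ne hp with hlt | hgt
    · exact h₃ p (by linarith [(abs_lt.1 hpδ₃).1]) hlt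
    · have hq1 : 1 / 2 - δ₃ < ((σ p : unitInterval) : ℝ) := by
        rw [unitInterval.coe_symm_eq]; linarith [(abs_lt.1 hpδ₃).2]
      have hq2 : ((σ p : unitInterval) : ℝ) < 1 / 2 := by
        rw [unitInterval.coe_symm_eq]; linarith
      have h := h₃ (σ p) hq1 hq2
      rwa [charLength_symm] at h
  have hba : b ≤ a := charLength_anti hsub hε hεε' hp
  have hA : (0 : ℝ) < a := by exact_mod_cast (show 0 < a by omega)
  have hB : (0 : ℝ) < b := by exact_mod_cast (show 0 < b by omega)
  have hx : 0 < |(p : ℝ) - 1 / 2| := abs_pos.2 (sub_ne_zero.2 hp)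
  have hK₁ := hb₁ p hp hpδ₁
  have hK₂ := hb₂ p hp hpδ₂
  rcases le_or_gt a (4 * b) with hle | hlt
  · -- `a ≤ 4 b`
    calc (a : ℝ) ≤ 4 * b := by exact_mod_cast hle
      _ ≤ K * b := mul_le_mul_of_nonneg_right (le_max_left _ _) hB.le
  · -- `4 b < a`: quasi-multiplicativity across `Λ_a ∖ Λ_{4b}` and the a priori bound
    have hQ' := hQ r₀ b a hrQ (by omega) hlt
    have hL' : cL * (4 * (b : ℝ) / a) ^ (2 - β) ≤ critFourArmProb (4 * b) a := by
      have h := hL (4 * b) a (by omega) hlt.le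
      rwa [Nat.cast_mul, Nat.cast_ofNat] at h
    have hcore := CharLengthEquivalence.core hA hB hx.le hc₂ hcQ hcL hβ measureReal_nonneg
      measureReal_nonneg hK₁ hK₂ hQ' hL'
    calc (a : ℝ) ≤ (C₁ / (c₂ * cQ * cL * (4 : ℝ) ^ (2 - β))) ^ β⁻¹ * b := hcore
      _ ≤ K * b := mul_le_mul_of_nonneg_right (le_max_right _ _) hB.le

/-- **Equivalence of lengths from Kesten's relation** (Nolin 2008, §7.3, Cor. 37 [arXiv
0711.4948: Cor. 35]): given `Nolin2008_prop34` (Kesten's relation `|p - 1/2| L_ε² π₄(L_ε) ≍ 1` for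
every `ε`) and the two four-arm facts, for `0 < ε ≤ ε' < 1/2` there are `δ, K > 0` with
`L_ε(p) ≤ K · L_{ε'}(p)` for `p ≠ 1/2`, `|p - 1/2| < δ`; with `L_{ε'} ≤ L_ε` (`charLength_anti`)
this is `L_ε ≍ L_{ε'}` as `p → 1/2`. [cite: Nolin2008, §7.3, Cor. 37 (arXiv 0711.4948: Cor. 35)] -/
theorem charLength_le_mul_charLength (hK : Nolin2008_prop34) (hQM : Werner2009_fourArm_quasiMult)
    (hLB : Werner2009_fourArm_lowerBound) {ε ε' : ℝ} (hε : 0 < ε) (hεε' : ε ≤ ε')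
    (hε' : ε' < 1 / 2) :
    ∃ δ > (0 : ℝ), ∃ K > (0 : ℝ), ∀ p : unitInterval, (p : ℝ) ≠ 1 / 2 → |(p : ℝ) - 1 / 2| < δ →
      (charLength ε p : ℝ) ≤ K * charLength ε' p := by
  refine charLength_le_mul_charLength_at hε hεε' hε' hQM hLB ?_ ?_
  · obtain ⟨r₁, hr₁⟩ := hK hε (hεε'.trans_lt hε')
    refine ⟨r₁, fun r₀ hr₀ => ?_⟩
    obtain ⟨δ, hδ, c, -, C, hb⟩ := hr₁ r₀ hr₀
    exact ⟨δ, hδ, C, fun p hp hpδ => (hb p hp hpδ).2⟩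
  · obtain ⟨r₁, hr₁⟩ := hK (hε.trans_le hεε') hε'
    refine ⟨r₁, fun r₀ hr₀ => ?_⟩
    obtain ⟨δ, hδ, c, hc, C, hb⟩ := hr₁ r₀ hr₀
    exact ⟨δ, hδ, c, hc, fun p hp hpδ => (hb p hp hpδ).1⟩

/-! ### Assemblies: `Nolin2008_cor41` and `Nolin2008_theta_asymp` for every `ε` -/

/-- **The comparison of lengths in the shape consumed by the tree's reductions** (Nolin 2008,
§7.3, Cor. 37 [arXiv 0711.4948: Cor. 35]): from `Nolin2008_prop34` and the two four-arm facts, for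
all `0 < ε₀ < ε < 1/2` there are `δ > 0` and `C` with `L_{ε₀}(p) ≤ C · L_ε(p)` for
`1/2 - δ < p < 1/2` — exactly the hypothesis `hlen` of `Nolin2008_lemma39_of_RSW_one_of_lengths` and
`Nolin2008_cor41_of_RSW_one_of_lengths` (`NearCriticalScalingProofs.lean`);
`charLength_le_mul_charLength` restricted to `p < 1/2`. [cite: Nolin2008, §7.3, Cor. 37 (arXiv 0711.4948: Cor. 35)] -/
theorem charLength_lengths_of_prop34 (hK : Nolin2008_prop34) (hQM : Werner2009_fourArm_quasiMult)
    (hLB : Werner2009_fourArm_lowerBound) :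
    ∀ ⦃ε₀ ε : ℝ⦄, 0 < ε₀ → ε₀ < ε → ε < 1 / 2 →
      ∃ δ > (0 : ℝ), ∃ C : ℝ, ∀ p : unitInterval, 1 / 2 - δ < (p : ℝ) → (p : ℝ) < 1 / 2 →
        (charLength ε₀ p : ℝ) ≤ C * charLength ε p := by
  intro ε₀ ε hε₀ hε₀ε hε
  obtain ⟨δ, hδ, K, -, hb⟩ := charLength_le_mul_charLength hK hQM hLB hε₀ hε₀ε.le hε
  refine ⟨δ, hδ, K, fun p hp1 hp2 => hb p hp2.ne ?_⟩
  rw [abs_lt]; constructor <;> linarith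

/-- **Lemma 39 for every `ε` from RSW near `1`, Kesten's relation and the two four-arm facts**
(Nolin 2008, §7.4, Lemma 39 with Remark 40 [arXiv 0711.4948: Lemma 37, Remark 38]: "The result
for any `ε ∈ (0, 1/2)` follows readily by using the equivalence of lengths"): the named fact
`Nolin2008_lemma39` (`NearCriticalArm.lean`) by `Nolin2008_lemma39_of_RSW_one_of_lengths`
(`NearCriticalScalingProofs.lean`) and `charLength_lengths_of_prop34`. [cite: Nolin2008, §7.4, Lemma 39 and Remark 40 (arXiv 0711.4948: Lemma 37, Remark 38)] -/
theorem Nolin2008_lemma39_of_prop34 (hone : Nolin2008_RSW_one) (hK : Nolin2008_prop34)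
    (hQM : Werner2009_fourArm_quasiMult) (hLB : Werner2009_fourArm_lowerBound) :
    Nolin2008_lemma39 :=
  Nolin2008_lemma39_of_RSW_one_of_lengths hone (charLength_lengths_of_prop34 hK hQM hLB)

/-- **Cor. 41 for every `ε` from RSW near `1`, Kesten's relation and the two four-arm facts**
(Nolin 2008, §7.4, Cor. 41 [arXiv 0711.4948: Cor. 39], through Lemma 39 and Cor. 37): the named
fact `Nolin2008_cor41` by `Nolin2008_cor41_of_RSW_one_of_lengths` (`NearCriticalScalingProofs.lean`)
and `charLength_lengths_of_prop34`. [cite: Nolin2008, §7.4, Cor. 41 with §7.3, Cor. 37 (arXiv 0711.4948: Cor. 39, Cor. 35)] -/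
theorem Nolin2008_cor41_of_prop34 (hone : Nolin2008_RSW_one) (hK : Nolin2008_prop34)
    (hQM : Werner2009_fourArm_quasiMult) (hLB : Werner2009_fourArm_lowerBound) :
    Nolin2008_cor41 :=
  Nolin2008_cor41_of_RSW_one_of_lengths hone (charLength_lengths_of_prop34 hK hQM hLB)

/-- **`θ(p) ≍ π₁(L_ε(p))` for every `ε ∈ (0, 1/2)` from named facts of the tree** (Nolin 2008,
§7.4, eq. (7.25)): `Nolin2008_theta_asymp` follows from the five near-critical arm estimates of
`TriThetaExponentFromFacts.lean` (`Werner2009_fourArm_quasiMult`, `Werner2009_fourArm_lowerBound`,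
`Nolin2008_halfPlane_twoArm`, `Werner2009_halfPlane_twoArm`, `Werner2009_pivotal_lowerBound`), the
RSW clause `Nolin2008_RSW_one`, and Kesten's relation `Nolin2008_prop34` — by
`Nolin2008_theta_asymp_of_facts` (`KestenScalingThetaProofs.lean`) and `Nolin2008_cor41_of_prop34`. [cite: Nolin2008, §7.4, eq. (7.25) (arXiv 0711.4948: display after Cor. 39)] -/
theorem Nolin2008_theta_asymp_of_prop34 (hQM : Werner2009_fourArm_quasiMult)
    (hLB : Werner2009_fourArm_lowerBound) (hHP : Nolin2008_halfPlane_twoArm)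
    (hHP' : Werner2009_halfPlane_twoArm) (hP : Werner2009_pivotal_lowerBound)
    (hone : Nolin2008_RSW_one) (hK : Nolin2008_prop34) : Nolin2008_theta_asymp :=
  Nolin2008_theta_asymp_of_facts hQM hLB hHP hHP' hP (Nolin2008_cor41_of_prop34 hone hK hQM hLB)

/-- **`θ(p) ≍ π₁(L_ε(p))` for every `ε ∈ (0, 1/2)`, with Kesten's relation supplied by the
pivotal count** (`Werner2009_lemma62`, through `Nolin2008_prop34_of_expDecay` and
`BollobasRiordan2006_tri_expDecay_holds`): the current leaves of `Nolin2008_theta_asymp` are the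
five near-critical arm estimates, `Nolin2008_RSW_one` and `Werner2009_lemma62`. [cite: Nolin2008, §7.4, eq. (7.25) (arXiv 0711.4948: display after Cor. 39)] -/
theorem Nolin2008_theta_asymp_of_lemma62 (hQM : Werner2009_fourArm_quasiMult)
    (hLB : Werner2009_fourArm_lowerBound) (hHP : Nolin2008_halfPlane_twoArm)
    (hHP' : Werner2009_halfPlane_twoArm) (hP : Werner2009_pivotal_lowerBound)
    (hone : Nolin2008_RSW_one) (h62 : Werner2009_lemma62) : Nolin2008_theta_asymp :=
  Nolin2008_theta_asymp_of_prop34 hQM hLB hHP hHP' hP hone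
    (Nolin2008_prop34_of_expDecay BollobasRiordan2006_tri_expDecay_holds h62)

end Literature.Probability.Percolation
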